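import Literature.NumberTheory.EllipticCurves.ZhangLevelRaisedKolyvaginData
import Literature.NumberTheory.EllipticCurves.ZhangLevelRaisedHeegnerData
import Literature.NumberTheory.EllipticCurves.HeegnerPointsOfConductor
import Literature.NumberTheory.EllipticCurves.HeegnerPointsKolyvaginPairing
import Literature.NumberTheory.EllipticCurves.OrdinaryLocalCondition
import Literature.NumberTheory.EllipticCurves.SelmerGaloisAction
import Literature.NumberTheory.EllipticCurves.BSDSelmer
import Literature.NumberTheory.EllipticCurves.PAdicLFunction
import Literature.NumberTheory.GaloisRepresentations.IntegralGaloisAction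
import HarnessLib

/-!
# W. Zhang 2014, §§3–4 and §8.1: the level-raised Heegner classes and their values as a BIPARTITE SYSTEM mod `p`
# — the printed properties as PREDICATES on a datum, and the existence of such a datum as ONE named fact

Source (held, read 2026-08-28: `paper:doi-10-4310-cjm-2014-v2-n2-a2`, printed page = file page): W. Zhang, *Selmer groups and the
indivisibility of Heegner points*, Camb. J. Math. **2** (2014) 191–253 [`WZhang2014`]; companions: M. Bertolini, H. Darmon, *Iwasawa's
main conjecture for elliptic curves over anticyclotomic ℤ_p-extensions*, Ann. of Math. 162 (2005) [`BertoliniDarmon2005`], Thms. 4.1, 4.2;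
B. H. Gross, *Kolyvagin's work on modular elliptic curves* (1991) [`GrossLMS1991`], §3–§5; W. G. McCallum, *Kolyvagin's work on
Shafarevich–Tate groups* (1991) [`McCallumLMS1991`], Prop. 4.4.

## What is typed (one file for the "bipartite system" content of §§3–4, §8.1; D-0064)

For an elliptic curve `E/ℚ` with globally minimal model `W`, a prime `p`, an imaginary quadratic field `K` with an embedding `ι : K → ℂ`,
a complex conjugation `c ∈ Aut(K/ℚ)`, and a modular parametrisation datum `Dt` with orientation `β` (the tree's currency for Heegner
points on `X₀(N)`, `N = N_E`, i.e. the case `N⁻ = 1` of the source), the STANDING HYPOTHESES of the source are (p. 193 "Notations"):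
*"Throughout this paper we assume that `ρ̄_{E,p}` is surjective, `p ∤ N`, and `p ≥ 5`"*, Notations (v) p. 200 *"The modular form `g` is
assumed to be good ordinary at `p`"* (tree `IsOrdinaryAt`), (p. 194) *"`K = ℚ[√−D]` … with `(D, N) = 1` … `N⁻` square-free"*, `p ∤ D_K`
(Thm. 1.1), and Hypothesis ♠ (p. 195; = Hypothesis ♥ of (xv) for the newform of `E`, Lemma 5.1 (2)).

* `LevelRaisedBipartiteData W K p` — DATA (no constraints): level signs `ε(m) ∈ ℤ` (meant `±1`), the level-raised Kolyvagin classes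
  `c(n, m) ∈ H¹(K, E[p])` ((3.30), p. 215: *"for each `n ∈ Λ` and `m ∈ Λ'^+` … the Kolyvagin cohomology class `c(n, m) ∈ H¹(K, J(X_m)[𝔪_m]) ≃ H¹(K, V)`
  … these classes only take values in `V`"*) and the ODD-level values `λ(n, m′) ∈ 𝔽_p` (the reduction of the `k₀`-valued Hecke eigenform `φ`
  on the Shimura SET `X_{m′}`, `m′ ∈ Λ'^−`, evaluated on the derived CM divisor of conductor `n` — (4.7)–(4.9), p. 218–219; Bertolini–Darmon's
  `ℒ`).  Indexing as in the tree's `ZhangLevelRaisedKolyvaginData` (M. 2026-08-26): a square-free level `m` as the `Finset` of its prime factors,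
  a Kolyvagin conductor `n : ℕ`; torsion level written `p ^ 1` (the tree's `KolyvaginHeegnerData.kolyvaginClass hp 1` convention).
* PREDICATES on a datum (each = one printed property, verbatim up to the tree's currency; no truth content by themselves):
  `IsRealisation` ((3.21)–(3.22)/(3.30) at `m = 1`: the bottom classes ARE Kolyvagin's classes of the Heegner points `y(n)` on `X₀(N)`),
  `IsSignEigen` (complex conjugation acts on `c(n, m)` by `ε(m)·(−1)^{ν(n)}`: Gross Prop. 5.4 (2) at `m = 1`; used at every `m` in §8.2,
  p. 237 *"c lies in the opposite eigenspace to c(n_{j+1}) under the complex conjugation"*), `SatisfiesKummerOff` / `SatisfiesKummerInf`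
  (§8.1 property (1), p. 235: *"For every prime `ℓ` (not only those in `Λ`) and `n ∈ Λ`, we have `loc_ℓ(c(n)) ∈ H¹_fin(K_ℓ, V)` if `(ℓ, n) = 1`"*,
  where *"the finite part `H¹_fin(K_ℓ, V)` is, by definition, the local condition `L_{ℓ,A,0}`"* and `L_{ℓ,A_m,0} = L_{ℓ,A,0}` for `ℓ ∉ m` by
  Thm. 5.2 iterated — E's own Kummer condition), `SatisfiesToricOn` (at `q ∈ m`: Thm. 5.2 *"`L_{q,A′,0} = H¹(K_q, k₀(1))`"* = (4.3) — the
  classes valued in the augmentation line `I_{Γ_{K_q}}·E[p]`), `SatisfiesTransverseOn` (§8.1 (1): *"`loc_ℓ(c(n)) ∈ H¹_tr(K_ℓ, V)` if `ℓ ∣ n`"*,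
  `H¹_tr` = classes inflated from `K[ℓ]_λ/K_λ`), `SatisfiesRelation` ((8.1), p. 235: *"`loc_ℓ(c(nℓ)) = ψ_ℓ(loc_ℓ(c(n)))`"* with `ψ_ℓ` an
  ISOMORPHISM (McCallum Prop. 4.4) — recorded as the equivalence of the two vanishings, which is all the consumers use),
  `SatisfiesFirstLaw` / `SatisfiesSecondLaw` (Thm. 4.3, p. 218: *"`loc_{q₁}(c(n, m)) ∈ H¹(K_{q₁}, k₀)`, `loc_{q₂}(c(n, m q₁q₂)) ∈ H¹(K_{q₂}, k₀(1))`.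
  Fixing isomorphisms (4.4) … we have an equality for all `n ∈ Λ`: (4.5) `loc_{q₁}(c(n, m)) = loc_{q₂}(c(n, m q₁ q₂))`, up to a unit"*; both
  sides equal the value `φ(Red(x))` of (4.9) — Bertolini–Darmon's first and second reciprocity laws Thm. 4.1/4.2 — recorded TWO-SIDEDLY in
  the unit ∕ non-vanishing currency: «`λ(n, m ∪ {q})` is a unit ⟺ `c(n, m)` is not locally trivial at `q`» and «`c(n, m′ ∪ {q})` is not
  locally trivial at `q` ⟺ `λ(n, m′)` is a unit»).
* ONE NAMED FACT `exists_levelRaisedBipartiteSystem` (statement only, no `_holds`): under the standing hypotheses a datum with all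
  nine properties EXISTS — the content of Thm. 2.1 (Ribet/Diamond–Taylor level raising), §3 (CM points on `X_{N⁺,N⁻m}` and the Shimura
  sets, Lemma 3.3 `J(X_m)[𝔪_m] ≃ V`), Thm. 4.3 with its proof (4.6)–(4.9) (incl. the multiplicity-one input (4.8)), Thm. 5.2 (Gross–Parson),
  §8.1 (1)–(2) and Gross Prop. 5.4 (2).

## Deliberately NOT here
The newforms `g_m`, Shimura curves/sets `X_m`, the quotients `A_m`, `φ` itself (the tree has no Shimura curves: TODO below); the
anchors Thm. 7.1/7.2 (Skinner–Urban; ordinariness enters the source ONLY there, §7.1 p. 231) and Thm. 9.1/9.3 — NOT part of this fact;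
general `(N⁺, N⁻)` and levels `M > 1` (the level-raised classes exist mod `𝔭_m` only).
-- TODO(general form): the source proves all of this for `N⁻` square-free with `ν(N⁻)` even and `A = A_g` of `GL₂`-type; typed here for
-- `E/ℚ`, `N⁻ = 1` (every prime of `N` split in `K` — the tree's `SatisfiesHeegnerHypothesis`), classes mod `p` (`M = 1`).

Consumers: the AKR crux KS′ (stmt-BirchSwinnertonDyer-21396, line `epsilon_matched_retyping`, stub `stub_lenderBipartiteDatum` — the LENDER's
bipartite datum at a `p`-GOOD level) and the KOLY crux at `p = 3` (stmt-BirchSwinnertonDyer-19574) read these predicates through a Summit-side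
dictionary (index sets `Finset (AdmQ …)`, `toricLocalKer`, `transverseLocalKerP` are definitionally the bodies inlined below).
-/

noncomputable section

open scoped Classical

universe u

namespace Literature.NumberTheory.EllipticCurves

namespace WZhang2014

open WeierstrassCurve NumberField IsDedekindDomain Literature.NumberTheory.GaloisRepresentations
  Literature.NumberTheory.EllipticCurves.ModularForms

section Data

variable (W : WeierstrassCurve ℚ) (K : Type) [Field K] [NumberField K] (p : ℕ)

/-- **W. Zhang's level-raised bipartite DATA mod `p`** for `E = W` over `K` (Camb. J. Math. 2 (2014) §§3–4): level signs
`ε(m)`, the level-raised Kolyvagin classes `c(n, m) ∈ H¹(K, E[p])` at the even admissible levels `m ∈ Λ'^+` and Kolyvagin conductors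
`n ∈ Λ` ((3.30)), and the values `λ(n, m′) ∈ 𝔽_p` at the odd admissible levels `m′ ∈ Λ'^−` ((4.7)–(4.9): the `k₀`-valued Jacquet–Langlands
eigenform `φ` on the Shimura set `X_{m′}` at the derived CM divisor of conductor `n`).  Pure data — values at non-admissible `m` ∕ non-Kolyvagin
`n` are junk; the printed properties are the predicates below and the existence of a datum satisfying them is the named fact
`exists_levelRaisedBipartiteSystem`.  Companion of `ZhangLevelRaisedKolyvaginData` (which pins the residual eigensystems and the bottom
class `c(1,1) = δ y_K` at torsion level `p`); here the torsion level is written `p ^ 1`, the convention of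
`KolyvaginHeegnerData.kolyvaginClass hp 1`. [cite: WZhang2014, §3.9 (3.30), Thm. 4.3 (4.7)–(4.9)] -/
structure LevelRaisedBipartiteData where
  /-- `m ↦ ε(m)`: the sign at the even admissible level `m` (meant: `±1`; complex conjugation acts on `c(n, m)` by `ε(m)(−1)^{ν(n)}`). -/
  sign : Finset ℕ → ℤ
  /-- `(m, n) ↦ c(n, m) ∈ H¹(K, E[p])` ((3.30); `m ∈ Λ'^+`, `n ∈ Λ`). -/
  kolyvaginClass : Finset ℕ → ℕ → galH1Torsion (W.baseChange K) ((p ^ 1 : ℕ) : ℤ)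
  /-- `(m′, n) ↦ λ(n, m′) ∈ 𝔽_p` ((4.7)–(4.9); `m′ ∈ Λ'^−`, `n ∈ Λ`). -/
  value : Finset ℕ → ℕ → ZMod p

end Data

section Predicates

variable {W : WeierstrassCurve ℚ} [W.IsGloballyMinimal] {K : Type} [Field K] [NumberField K] {p : ℕ} [hp : Fact p.Prime]

/-- The EVEN admissible levels `m ∈ Λ'^+` for `E = W` at `N = N_E`, `a_ℓ = a_ℓ(E)`: the tree's `IsZhangEvenAdmissibleLevel`
(Notations (xiv); finite sets of Bertolini–Darmon `1`-admissible primes of even cardinality), with its parameters specialised — an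
abbreviation, not a new notion. [cite: WZhang2014, Notations (xiv)] -/
abbrev IsEvenLevel (m : Finset ℕ) : Prop :=
  IsZhangEvenAdmissibleLevel (W.conductorNorm ℤ) K (fun ℓ ↦ W.frobeniusTrace ℓ) p m

/-- The ODD admissible levels `m′ ∈ Λ'^−` (Notations (xiv): admissible, `(−1)^{ν(m′)} = −1`; the levels carrying Shimura SETS §3.3 and the
values `λ`), over the tree's `IsZhangAdmissibleLevel`. [cite: WZhang2014, Notations (xiv) and §3.3 (m ∈ Λ'^−)] -/
def IsOddLevel (m : Finset ℕ) : Prop :=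
  IsZhangAdmissibleLevel (W.conductorNorm ℤ) K (fun ℓ ↦ W.frobeniusTrace ℓ) p m ∧ Odd m.card

/-- The Kolyvagin conductors `n ∈ Λ`: square-free products of Kolyvagin primes in the sense of the source's Notations (xii)
(tree `Zhang2014.IsKolyvaginPrime`, via `KolyvaginDescent.KolSupp`). [cite: WZhang2014, Notations (xii)] -/
def IsKolyvaginConductor (n : ℕ) : Prop :=
  KolyvaginDescent.KolSupp (Zhang2014.IsKolyvaginPrime (W.conductorNorm ℤ) W K p) n

namespace LevelRaisedBipartiteData

variable {N : ℕ} [NeZero N]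

/-- **REALISATION at the bottom level** ((3.21)–(3.22) and (3.30) at `m = 1`, p. 213/215: `c(n) = c(n, 1)` is Kolyvagin's derived
class of the Heegner point `y(n)` of conductor `n` on `X₀(N)`): for every Kolyvagin conductor `n` the bottom class `c(n, ∅)` is the
Kolyvagin class mod `p` of SOME Kolyvagin–Heegner datum of conductor `n` on the parametrisation `(Dt, β, ι)` (the tree's
`KolyvaginHeegnerData.kolyvaginClass hp 1`; the choices of Remark 8 — `σ_ℓ`, coset representatives, the embedding — live in the datum).
[cite: WZhang2014, §3.7 (3.21)–(3.22), §3.9 (3.30), Remark 8] [cite: GrossLMS1991, §3–§4] -/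
def IsRealisation (d : LevelRaisedBipartiteData W K p) (Dt : ModularParametrizationData W N) (β : ℤ) (ι : K →+* ℂ) : Prop :=
  ∀ n : ℕ, IsKolyvaginConductor (W := W) (K := K) (p := p) n →
    ∃ dKH : KolyvaginHeegnerData Dt β ι n, d.kolyvaginClass ∅ n = dKH.kolyvaginClass hp.out 1

/-- **SIGN** (Gross 1991 Prop. 5.4 (2) at `m = 1`; W. Zhang §8.2 p. 237 at every level): complex conjugation `c` acts on `c(n, m)` by the
sign `ε(m)·(−1)^{ν(n)}`, `ν(n)` the number of prime factors of `n` (tree `conjAct`). [cite: GrossLMS1991, Prop. 5.4 (2)]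
[cite: WZhang2014, §8.2 (proof of Lemma 8.4)] -/
def IsSignEigen (d : LevelRaisedBipartiteData W K p) (c : K ≃ₐ[ℚ] K) : Prop :=
  ∀ m : Finset ℕ, IsEvenLevel (W := W) (K := K) (p := p) m → ∀ n : ℕ, IsKolyvaginConductor (W := W) (K := K) (p := p) n →
    conjAct W c ((p ^ 1 : ℕ) : ℤ) (d.kolyvaginClass m n) =
      (d.sign m * (-1) ^ n.primeFactors.card) • d.kolyvaginClass m n

/-- **Property (1) OFF the level and the conductor, finite places** (§8.1 p. 235 + Thm. 5.2): at a finite place `v` of `K` above no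
prime of `m` and no prime factor of `n`, `c(n, m)` satisfies E's own Kummer condition (`H¹_fin(K_ℓ, V) = L_{ℓ,A_m,0} = L_{ℓ,A,0}` for
`ℓ ∉ m`, Gross–Parson). [cite: WZhang2014, §8.1 property (1), Thm. 5.2] -/
def SatisfiesKummerOff (d : LevelRaisedBipartiteData W K p) : Prop :=
  ∀ m : Finset ℕ, IsEvenLevel (W := W) (K := K) (p := p) m → ∀ n : ℕ, IsKolyvaginConductor (W := W) (K := K) (p := p) n →
    ∀ v : HeightOneSpectrum (𝓞 K), (∀ q ∈ m, ((q : ℕ) : 𝓞 K) ∉ v.asIdeal) → (∀ ℓ ∈ n.primeFactors, ((ℓ : ℕ) : 𝓞 K) ∉ v.asIdeal) →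
      d.kolyvaginClass m n ∈ selmerLocalKer (W.baseChange K) (v.adicCompletion K) ((p ^ 1 : ℕ) : ℤ)

/-- **Property (1) at the infinite places**: `c(n, m)` satisfies the (empty, for complex places) Kummer condition at every infinite place.
[cite: WZhang2014, §8.1 property (1)] -/
def SatisfiesKummerInf (d : LevelRaisedBipartiteData W K p) : Prop :=
  ∀ m : Finset ℕ, IsEvenLevel (W := W) (K := K) (p := p) m → ∀ n : ℕ, IsKolyvaginConductor (W := W) (K := K) (p := p) n →
    ∀ w : InfinitePlace K, d.kolyvaginClass m n ∈ selmerLocalKer (W.baseChange K) w.Completion ((p ^ 1 : ℕ) : ℤ)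

/-- **TORIC at the level primes** (Thm. 5.2: `L_{q,A_m,0} = H¹(K_q, k₀(1))` for `q ∈ m`, with (4.3)): at a place `v` above `q ∈ m` the
localisation of `c(n, m)` is represented by a cocycle valued in the augmentation line `I_{Γ_{K_v}}·E[p] = k₀(1)` (Bertolini–Darmon's
`H¹_ord`; the tree's `valuedLocalKer` with the augmentation subgroup — definitionally the Summit-side `toricLocalKer`).
[cite: WZhang2014, Thm. 5.2, Thm. 4.3 (4.3)] [cite: BertoliniDarmon2005, §2.2–§2.3] -/
def SatisfiesToricOn (d : LevelRaisedBipartiteData W K p) : Prop :=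
  ∀ m : Finset ℕ, IsEvenLevel (W := W) (K := K) (p := p) m → ∀ n : ℕ, IsKolyvaginConductor (W := W) (K := K) (p := p) n →
    ∀ q ∈ m, ∀ v : HeightOneSpectrum (𝓞 K), ((q : ℕ) : 𝓞 K) ∈ v.asIdeal →
      d.kolyvaginClass m n ∈ (W.baseChange K).valuedLocalKer (v.adicCompletion K) ((p ^ 1 : ℕ) : ℤ)
        (AddSubgroup.closure {x | ∃ (g : Field.absoluteGaloisGroup (v.adicCompletion K))
          (y : AddSubgroup.torsionBy (localPoints (W.baseChange K) (v.adicCompletion K)) ((p ^ 1 : ℕ) : ℤ)), x = g • y - y})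

/-- **TRANSVERSE at the conductor primes** (§8.1 property (1): `loc_ℓ(c(n)) ∈ H¹_tr(K_ℓ, V)` for `ℓ ∣ n`, `H¹_tr` the classes inflated from
the completed ring class field `K[ℓ]_λ/K_λ`, Gross §3–§4): at a place `v` above a prime factor `ℓ` of `n`, the cocycle value of `c(n, m)`
vanishes at every element of the decomposition group of a prime over `v` that fixes `K[ℓ]` and `E[p]` (definitionally the Summit-side
`transverseLocalKerP`). [cite: WZhang2014, §8.1 property (1) (H¹_tr)] [cite: GrossLMS1991, §3–§4] -/
def SatisfiesTransverseOn (d : LevelRaisedBipartiteData W K p) (ι : K →+* ℂ) : Prop :=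
  ∀ m : Finset ℕ, IsEvenLevel (W := W) (K := K) (p := p) m → ∀ n : ℕ, IsKolyvaginConductor (W := W) (K := K) (p := p) n →
    ∀ ℓ ∈ n.primeFactors, ∀ v : HeightOneSpectrum (𝓞 K), ((ℓ : ℕ) : 𝓞 K) ∈ v.asIdeal →
      ∀ 𝔓 ∈ v.primesAbove, ∀ g : Field.absoluteGaloisGroup K,
        g ∈ 𝔓.decompositionSubgroup (Field.absoluteGaloisGroup K) → g ∈ ringClassStabilizer K ι ℓ ℓ →
        g ∈ torsionFixing (W.baseChange K) ((p ^ 1 : ℕ) : ℤ) →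
        h1Eval (W.baseChange K) ((p ^ 1 : ℕ) : ℤ) (d.kolyvaginClass m n) g = 0

/-- **Relation (8.1)** (p. 235: *"`loc_ℓ(c(nℓ)) = ψ_ℓ(loc_ℓ(c(n)))`"* with the finite/singular map `ψ_ℓ` an ISOMORPHISM, McCallum Prop. 4.4),
recorded as what it yields for vanishing: for a Kolyvagin prime `ℓ ∤ n` with `nℓ ∈ Λ`, `c(nℓ, m)` is locally trivial above `ℓ` iff
`c(n, m)` is. [cite: WZhang2014, §8.1 (8.1)] [cite: McCallumLMS1991, Prop. 4.4] -/
def SatisfiesRelation (d : LevelRaisedBipartiteData W K p) : Prop :=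
  ∀ m : Finset ℕ, IsEvenLevel (W := W) (K := K) (p := p) m → ∀ n ℓ : ℕ, IsKolyvaginConductor (W := W) (K := K) (p := p) (n * ℓ) →
    ℓ.Prime → ¬ ℓ ∣ n → ∀ v : HeightOneSpectrum (𝓞 K), ((ℓ : ℕ) : 𝓞 K) ∈ v.asIdeal →
      (d.kolyvaginClass m (n * ℓ) ∈ (W.baseChange K).torsionLocalKer (v.adicCompletion K) ((p ^ 1 : ℕ) : ℤ) ↔
        d.kolyvaginClass m n ∈ (W.baseChange K).torsionLocalKer (v.adicCompletion K) ((p ^ 1 : ℕ) : ℤ))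

/-- **FIRST RECIPROCITY LAW, two-sided** (Thm. 4.3, first half of (4.5) with (4.6)–(4.9): `loc_{q}(c(n, m)) = φ_{m∪q}(Red_q(·)) = λ(n, m ∪ {q})`
under `H¹_fin(K_q, V) ≃ k₀`; Bertolini–Darmon Thm. 4.2): for an even level `m` and an admissible `q ∉ m`, the value one level up is a unit iff
the class is NOT locally trivial above `q`. [cite: WZhang2014, Thm. 4.3 (4.5)–(4.9)] [cite: BertoliniDarmon2005, Thm. 4.2] -/
def SatisfiesFirstLaw (d : LevelRaisedBipartiteData W K p) : Prop :=
  ∀ m : Finset ℕ, IsEvenLevel (W := W) (K := K) (p := p) m → ∀ q : ℕ, q ∉ m →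
    IsOddLevel (W := W) (K := K) (p := p) (insert q m) → ∀ n : ℕ, IsKolyvaginConductor (W := W) (K := K) (p := p) n →
      (d.value (insert q m) n ≠ 0 ↔ ∃ v : HeightOneSpectrum (𝓞 K), ((q : ℕ) : 𝓞 K) ∈ v.asIdeal ∧
        d.kolyvaginClass m n ∉ (W.baseChange K).torsionLocalKer (v.adicCompletion K) ((p ^ 1 : ℕ) : ℤ))

/-- **SECOND RECIPROCITY LAW, two-sided** (Thm. 4.3, second half of (4.5): `loc_{q₂}(c(n, m q₁q₂)) ∈ H¹(K_{q₂}, k₀(1))` equals the same value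
`λ(n, m q₁)`; Bertolini–Darmon Thm. 4.1): for an odd level `m′` and an admissible `q ∉ m′`, the class one level up is NOT locally trivial above
`q` iff the value at `m′` is a unit. [cite: WZhang2014, Thm. 4.3 (4.3)–(4.5)] [cite: BertoliniDarmon2005, Thm. 4.1] -/
def SatisfiesSecondLaw (d : LevelRaisedBipartiteData W K p) : Prop :=
  ∀ m : Finset ℕ, IsOddLevel (W := W) (K := K) (p := p) m → ∀ q : ℕ, q ∉ m →
    IsEvenLevel (W := W) (K := K) (p := p) (insert q m) → ∀ n : ℕ, IsKolyvaginConductor (W := W) (K := K) (p := p) n →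
      ((∃ v : HeightOneSpectrum (𝓞 K), ((q : ℕ) : 𝓞 K) ∈ v.asIdeal ∧
        d.kolyvaginClass (insert q m) n ∉ (W.baseChange K).torsionLocalKer (v.adicCompletion K) ((p ^ 1 : ℕ) : ℤ)) ↔
        d.value m n ≠ 0)

end LevelRaisedBipartiteData

end Predicates

section Fact

/-- **W. Zhang 2014, §§3–4 + §8.1 (with Thm. 2.1, Lemma 3.3, Thm. 5.2; Bertolini–Darmon 2005 Thms. 4.1/4.2; Gross 1991 Prop. 5.4):
EXISTENCE OF THE LEVEL-RAISED BIPARTITE SYSTEM mod `p`** — statement only.  For `E = W` globally minimal of conductor `N`, a prime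
`p ≥ 5` of GOOD ORDINARY reduction (*"Throughout this paper we assume that `ρ̄_{E,p}` is surjective, `p ∤ N`, and `p ≥ 5`"*, p. 193;
Notations (i) `(p, N) = 1` and (v) *"The modular form `g` is assumed to be good ordinary at `p`"*, p. 200 — a STANDING hypothesis of the
source, carried here although the proofs of Thm. 4.3/5.2/§8.1 do not use it), `ρ̄_{E,p}` surjective,
Hypothesis ♠ (p. 195: (1) `ρ̄` ramified at every `ℓ ∥ N` — for `p ∤ ord_ℓ(Δ_E)`, Tate; (2) when `N` is not square-free, at least two primes
`ℓ ∥ N`), `K` imaginary quadratic with `d_K < −4` (unit group `±1`, as in Gross 1991) and `p ∤ d_K`, every prime of `N` split in `K` (the case `N⁻ = 1`),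
an orientation `β` (`4N ∣ β² − d_K`)
and a parametrisation `Dt`, and a complex conjugation `c ≠ 1`: there is a datum `(ε, c(·,·), λ(·,·))` realising Kolyvagin's classes at the
bottom level and satisfying the sign property, property (1) off/at infinity/toric/transverse, the relation (8.1) and both reciprocity laws.
NO rank hypothesis (the anchors Thm. 7.1/7.2/9.3 are not part of this fact).  Proof in the source: Thm. 2.1 (Ribet, Diamond–Taylor
level raising), §3.1–§3.4 (CM points on `X_{N⁺,N⁻m}` and on the Shimura sets), Lemma 3.3 / (3.29)–(3.30) (Helm's multiplicity one, under
Hyp. ♥), Thm. 4.3 with (4.6)–(4.9) and (4.8), Thm. 5.2 (Gross–Parson), §8.1 (Gross §3–§5, McCallum Prop. 4.4).  Size XL; no `_holds`.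
[cite: WZhang2014, Thm. 2.1, §3.9 Lemma 3.3 and (3.30), Thm. 4.3, Thm. 5.2, §8.1] [cite: BertoliniDarmon2005, Thm. 4.1, Thm. 4.2]
[cite: GrossLMS1991, Prop. 5.4] -/
def exists_levelRaisedBipartiteSystem : Prop :=
  ∀ (W : WeierstrassCurve ℚ) [W.IsElliptic] [W.IsGloballyMinimal] [NeZero (W.conductorNorm ℤ)] (p : ℕ) [Fact p.Prime]
    (K : Type) [Field K] [NumberField K] (Dt : ModularParametrizationData W (W.conductorNorm ℤ)) (β : ℤ) (ι : K →+* ℂ)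
    (c : K ≃ₐ[ℚ] K),
    5 ≤ p → IsOrdinaryAt W p → W.HasSurjectiveModNGaloisRep p →
    (∀ (ℓ : ℕ) [Fact ℓ.Prime], W.HasMultiplicativeReductionAtPrime ℓ → ¬ p ∣ padicValInt ℓ W.minimalDiscriminantInt) →
    (Squarefree (W.conductorNorm ℤ) ∨ ∃ (ℓ₁ ℓ₂ : ℕ) (_ : Fact ℓ₁.Prime) (_ : Fact ℓ₂.Prime), ℓ₁ ≠ ℓ₂ ∧
      W.HasMultiplicativeReductionAtPrime ℓ₁ ∧ W.HasMultiplicativeReductionAtPrime ℓ₂) →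
    IsImaginaryQuadratic K → NumberField.discr K < -4 → ¬ ((p : ℤ) ∣ NumberField.discr K) →
    SatisfiesHeegnerHypothesis (W.conductorNorm ℤ) K →
    (4 * (W.conductorNorm ℤ : ℤ)) ∣ β ^ 2 - NumberField.discr K → c ≠ 1 →
    ∃ d : LevelRaisedBipartiteData W K p,
      (∀ m, d.sign m = 1 ∨ d.sign m = -1) ∧ d.IsRealisation Dt β ι ∧ d.IsSignEigen c ∧ d.SatisfiesKummerOff ∧ d.SatisfiesKummerInf ∧
        d.SatisfiesToricOn ∧ d.SatisfiesTransverseOn ι ∧ d.SatisfiesRelation ∧ d.SatisfiesFirstLaw ∧ d.SatisfiesSecondLaw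

end Fact

end WZhang2014

end Literature.NumberTheory.EllipticCurves

end
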